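import Mathlib
import HarnessLib

/-!
# The fibre line of a point blow-up at `τ = 1`: switching from the `u₂`-chart to the `u₁`-chart (pure algebra)

Topic: `Literature/AlgebraicGeometry/Resolution`; companion of `PointCentreFibreLine.lean` (the ring-level
closed-point dichotomy on a chart) and input of `PointStepTrichotomy.lean`. [CoP1] Lemma 4.3 (5) and the
proof of Prop. 4.4 (p. 12) present a near closed point `x′` of the blowing up of a `τ = 1` point EITHER in
the `u₁`-chart (`x′ = (0:1:λ)`, `λ ∈ k(x)` or non-rational) OR as the origin `x′ = (0:0:1)` of the
`u₂`-chart. The chart dictionary (`IsBlowup.exists_reesChart_stalk`) may however present `x′` in the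
`u₂`-chart although `x′` is not its origin; then `s = u₁/u₂` is a UNIT of `𝒪_{x′}` and `x′` also lies in
the `u₁`-chart, with `u₂/u₁ = s⁻¹`. This file performs that change of presentation at the ring level, for
a ring map `φ : R → A` to a local ring and elements `y₂ = y/u₂`, `s = u₁/u₂`:

* `chartSwitch_rational` — rational case: from `𝔪_A = (y₂, φ u₂, s − φ a)` with `a` a unit of `R` to
  `𝔪_A = (s⁻¹ y₂, φ u₁, s⁻¹ − φ a⁻¹)`, i.e. the `u₁`-chart presentation after the shear `u₂ ↦ u₂ − a⁻¹ u₁`;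
* `chartSwitch_nonRational` — non-rational case: from `𝔪_A = (y₂, φ u₂, P(s))`, `P` monic with `P̄`
  irreducible of degree `d ≥ 2` and `G(s) ∈ 𝔪_A ⟺ P̄ ∣ Ḡ`, to the same data for `t = s⁻¹` and the monic
  RECIPROCAL polynomial `P′ = P(0)⁻¹ · T^d P(1/T)` (Mathlib `Polynomial.reflect`);
* the weak-transform colon `(J A : φ(u₂)^μ) = (J A : φ(u₁)^μ)` in both cases (unit multiples);
* tools: `Ideal.span_triple_eq_of_isUnit_mul`, `Submodule.colon_singleton_eq_of_isUnit_mul`,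
  `Polynomial.dvd_reflect_iff_reflect_dvd`, `irreducible_map_residue_of_criterion`.

Everything is PROVED (no `sorry`, no definitions, no named facts); OURS rendering of a routine step that
[CoP1] leaves implicit ("by symmetry"). F-71 / T1 NOT proved; no summit statement proved. AI-written.

## Sources

* V. Cossart, O. Piltant, J. Algebra 320 (2008), Lemma 4.3 (5); proof of Prop. 4.4, p. 12. [CossartPiltant2008]
* The Stacks Project, Tag 0804 (charts of a blowing up and their intersections). [StacksProject]
-/

noncomputable section

open IsLocalRing

namespace Literature.AlgebraicGeometry.Resolution

/-! ## Unit multiples -/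

/-- Unit multiples of three generators generate the same ideal. [cite: StacksProject, Tag 0804] -/
theorem Ideal.span_triple_eq_of_isUnit_mul {A : Type*} [CommRing A] {u v w : A} (hu : IsUnit u)
    (hv : IsUnit v) (hw : IsUnit w) (x y z : A) :
    Ideal.span {u * x, v * y, w * z} = Ideal.span {x, y, z} := by
  simp only [Ideal.span_insert, Ideal.span_singleton_mul_left_unit hu,
    Ideal.span_singleton_mul_left_unit hv, Ideal.span_singleton_mul_left_unit hw]

/-- The colon by a unit multiple. [cite: StacksProject, Tag 0804] -/
theorem Submodule.colon_singleton_eq_of_isUnit_mul {A : Type*} [CommRing A] (N : Ideal A) {u : A}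
    (hu : IsUnit u) (x : A) :
    Submodule.colon N ({u * x} : Set A) = Submodule.colon N ({x} : Set A) := by
  rw [← Ideal.colon_span (S := {u * x}), ← Ideal.colon_span (S := {x}),
    Ideal.span_singleton_mul_left_unit hu]

/-! ## Reciprocal polynomials -/

/-- For `p` monic with `p(0) ≠ 0` over a field and `deg q ≤ N`:
`p ∣ T^N q(1/T) ⟺ T^{deg p} p(1/T) ∣ q`. [cite: StacksProject, Tag 0804] -/
theorem Polynomial.dvd_reflect_iff_reflect_dvd {k : Type*} [Field k] {p q : Polynomial k}
    (hp : p.Monic) (hp0 : p.coeff 0 ≠ 0) {N : ℕ} (hq : q.natDegree ≤ N) :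
    p ∣ q.reflect N ↔ p.reflect p.natDegree ∣ q := by
  have hdle : (p.reflect p.natDegree).natDegree ≤ p.natDegree :=
    Polynomial.natDegree_reflect_le.trans (le_of_eq (max_self _))
  have hcoef : (p.reflect p.natDegree).coeff p.natDegree = p.coeff 0 := by
    rw [Polynomial.coeff_reflect, Polynomial.revAt_le le_rfl, Nat.sub_self]
  have hdeq : (p.reflect p.natDegree).natDegree = p.natDegree :=
    le_antisymm hdle (Polynomial.le_natDegree_of_ne_zero (by rw [hcoef]; exact hp0))
  have hlc : (p.reflect p.natDegree).leadingCoeff ≠ 0 := by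
    rw [Polynomial.leadingCoeff, hdeq, hcoef]; exact hp0
  have hqN : (q.reflect N).natDegree ≤ N := Polynomial.natDegree_reflect_le.trans (max_le le_rfl hq)
  constructor
  · rintro ⟨H, hH⟩
    by_cases hH0 : H = 0
    · rw [hH0, mul_zero, Polynomial.reflect_eq_zero_iff] at hH
      rw [hH]; exact dvd_zero _
    have hdeg : p.natDegree + H.natDegree ≤ N := by
      rw [← hp.natDegree_mul' hH0, ← hH]; exact hqN
    refine ⟨H.reflect (N - p.natDegree), ?_⟩
    have hN : N = p.natDegree + (N - p.natDegree) := by omega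
    rw [← Polynomial.reflect_reflect (N := N) (p := q), hH]
    conv_lhs => rw [hN]
    rw [Polynomial.reflect_mul _ _ le_rfl (by omega)]
  · rintro ⟨H, hH⟩
    by_cases hH0 : H = 0
    · rw [hH0, mul_zero] at hH
      rw [hH, Polynomial.reflect_zero]; exact dvd_zero _
    have hdeg : p.natDegree + H.natDegree ≤ N := by
      have h1 : (p.reflect p.natDegree * H).natDegree = p.natDegree + H.natDegree := by
        rw [Polynomial.natDegree_mul' (by rw [mul_ne_zero_iff]; exact ⟨hlc,
          Polynomial.leadingCoeff_ne_zero.mpr hH0⟩), hdeq]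
      rw [← h1, ← hH]; exact hq
    refine ⟨H.reflect (N - p.natDegree), ?_⟩
    have hN : N = p.natDegree + (N - p.natDegree) := by omega
    rw [hH]
    conv_lhs => rw [hN]
    rw [Polynomial.reflect_mul _ _ hdle (by omega), Polynomial.reflect_reflect]

/-- A residue criterion `G(t) ∈ 𝔪_A ⟺ Q̄ ∣ Ḡ` (all `G ∈ R[T]`) forces `Q̄` to be prime, hence irreducible,
as soon as `deg Q̄ ≥ 1`: `k(R)[T]/(Q̄)` embeds into the residue field of `A`. [cite: StacksProject, Tag 0804] -/
theorem irreducible_map_residue_of_criterion {R A : Type*} [CommRing R] [IsLocalRing R] [CommRing A]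
    [IsLocalRing A] (φ : R →+* A) (t : A) {Q : Polynomial R} (hQ1 : 1 ≤ (Q.map (residue R)).natDegree)
    (hcrit : ∀ G : Polynomial R, G.eval₂ φ t ∈ maximalIdeal A ↔
      Q.map (residue R) ∣ G.map (residue R)) :
    Irreducible (Q.map (residue R)) := by
  have hQ0 : Q.map (residue R) ≠ 0 := fun h => by
    rw [h, Polynomial.natDegree_zero] at hQ1; omega
  have hnu : ¬ IsUnit (Q.map (residue R)) := fun h => by
    rw [Polynomial.natDegree_eq_zero_of_isUnit h] at hQ1; omega
  refine Prime.irreducible ⟨hQ0, hnu, fun a b hab => ?_⟩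
  obtain ⟨G, rfl⟩ := Polynomial.map_surjective _ residue_surjective a
  obtain ⟨H, rfl⟩ := Polynomial.map_surjective _ residue_surjective b
  rw [← Polynomial.map_mul, ← hcrit, Polynomial.eval₂_mul] at hab
  rcases (Ideal.IsPrime.mem_or_mem inferInstance hab) with h | h
  · exact Or.inl ((hcrit G).mp h)
  · exact Or.inr ((hcrit H).mp h)

/-! ## The chart switch -/

/-- **Rational near point presented in the `u₂`-chart, away from its origin ⇒ `u₁`-chart presentation.**
`φ : R → A`, `A` local, `φ u₀ = φ u₂ · y₂`, `φ u₁ = φ u₂ · s`, `𝔪_A = (y₂, φ u₂, s − φ a)` with `a` a unit of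
`R`: then `s` is a unit, and with `a′ = a⁻¹`, `c′ = (s⁻¹ y₂, φ u₁, s⁻¹ − φ a′)`: `φ u₀ = φ u₁ · c′₀`,
`φ(u₂ − a′ u₁) = φ u₁ · c′₂`, `𝔪_A = (c′)`, and `(N : φ(u₂)^μ) = (N : φ(u₁)^μ)`.
[cite: CossartPiltant2008, Lemma 4.3 (5); proof of Prop. 4.4, p. 12] -/
theorem chartSwitch_rational {R A : Type*} [CommRing R] [CommRing A] [IsLocalRing A]
    (φ : R →+* A) {u₀ u₁ u₂ a : R} (ha : IsUnit a) {y₂ s : A}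
    (h0 : φ u₀ = φ u₂ * y₂) (h1 : φ u₁ = φ u₂ * s)
    (hgen : Ideal.span {y₂, φ u₂, s - φ a} = maximalIdeal A) (N : Ideal A) (μ : ℕ) :
    ∃ (a' : R) (c' : Fin 3 → A), c' 1 = φ u₁ ∧ φ u₀ = φ u₁ * c' 0 ∧
      φ (u₂ - a' * u₁) = φ u₁ * c' 2 ∧ Ideal.span {c' 0, c' 1, c' 2} = maximalIdeal A ∧
      Submodule.colon N ({φ u₂ ^ μ} : Set A) = Submodule.colon N ({φ u₁ ^ μ} : Set A) := by
  obtain ⟨aU, rfl⟩ := ha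
  have hsa : s - φ ↑aU ∈ maximalIdeal A :=
    hgen ▸ Ideal.subset_span (Set.mem_insert_of_mem _ (Set.mem_insert_of_mem _ (Set.mem_singleton _)))
  have hs : IsUnit s := by
    by_contra hns
    have hsm : s ∈ maximalIdeal A := (IsLocalRing.mem_maximalIdeal s).mpr (mem_nonunits_iff.mpr hns)
    have h2 : φ (↑aU : R) ∈ maximalIdeal A := by
      have h3 := Ideal.sub_mem _ hsm hsa
      rwa [sub_sub_cancel] at h3
    exact (IsLocalRing.mem_maximalIdeal _).mp h2 ((Units.map (φ : R →* A) aU).isUnit)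
  obtain ⟨sU, rfl⟩ := hs
  have hss : ((↑sU⁻¹ : A)) * ↑sU = 1 := Units.inv_mul _
  have haa : φ (↑aU⁻¹ : R) * φ ↑aU = 1 := by rw [← map_mul, Units.inv_mul, map_one]
  refine ⟨↑aU⁻¹, ![↑sU⁻¹ * y₂, φ u₁, ↑sU⁻¹ - φ ↑aU⁻¹], rfl, ?_, ?_, ?_, ?_⟩
  · show φ u₀ = φ u₁ * (↑sU⁻¹ * y₂)
    rw [h0, h1, mul_assoc, Units.mul_inv_cancel_left]
  · show φ (u₂ - ↑aU⁻¹ * u₁) = φ u₁ * (↑sU⁻¹ - φ ↑aU⁻¹)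
    rw [map_sub, map_mul, h1]
    linear_combination (-(φ u₂)) * hss
  · show Ideal.span {↑sU⁻¹ * y₂, φ u₁, ↑sU⁻¹ - φ ↑aU⁻¹} = maximalIdeal A
    have e2 : φ u₁ = ↑sU * φ u₂ := by rw [h1, mul_comm]
    have e3 : (↑sU⁻¹ : A) - φ ↑aU⁻¹ = -(↑sU⁻¹ * φ ↑aU⁻¹) * (↑sU - φ ↑aU) := by
      linear_combination (-(↑sU⁻¹ : A)) * haa + (φ ↑aU⁻¹) * hss
    rw [e2, e3, Ideal.span_triple_eq_of_isUnit_mul (sU⁻¹).isUnit sU.isUnit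
      (((sU⁻¹).isUnit.mul ((aU⁻¹).isUnit.map φ)).neg), hgen]
  · have e : φ u₁ ^ μ = ↑(sU ^ μ) * φ u₂ ^ μ := by rw [h1, mul_pow, mul_comm, Units.val_pow_eq_pow_val]
    rw [e, Submodule.colon_singleton_eq_of_isUnit_mul N (sU ^ μ).isUnit]

set_option maxHeartbeats 400000 in
-- many algebraic identities between units; moderate
/-- **Non-rational near point presented in the `u₂`-chart ⇒ `u₁`-chart presentation with the reciprocal
polynomial.** `φ : R → A` (`R`, `A` local), `φ u₀ = φ u₂ · y₂`, `φ u₁ = φ u₂ · s`, `P ∈ R[T]` monic with `P̄`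
irreducible of degree `≥ 2`, `G(s) ∈ 𝔪_A ⟺ P̄ ∣ Ḡ` for all `G`, `𝔪_A = (y₂, φ u₂, P(s))`. Then `s` is a
unit, and for `t = s⁻¹` and the monic reciprocal polynomial `P′ = P(0)⁻¹ T^d P(1/T)`: `P̄′` is irreducible
of degree `≥ 2`, `G(t) ∈ 𝔪_A ⟺ P̄′ ∣ Ḡ`, `𝔪_A = (t y₂, φ u₁, P′(t))`, and `(N : φ(u₂)^μ) = (N : φ(u₁)^μ)`.
[cite: CossartPiltant2008, Lemma 4.3 (5); proof of Prop. 4.4, p. 12] -/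
theorem chartSwitch_nonRational {R A : Type*} [CommRing R] [IsLocalRing R] [CommRing A] [IsLocalRing A]
    (φ : R →+* A) {u₀ u₁ u₂ : R} {y₂ s : A} (h0 : φ u₀ = φ u₂ * y₂) (h1 : φ u₁ = φ u₂ * s)
    {P : Polynomial R} (hPm : P.Monic) (hP2 : 2 ≤ (P.map (residue R)).natDegree)
    (hPi : Irreducible (P.map (residue R)))
    (hcrit : ∀ G : Polynomial R, G.eval₂ φ s ∈ maximalIdeal A ↔
      P.map (residue R) ∣ G.map (residue R))
    (hgen : Ideal.span {y₂, φ u₂, P.eval₂ φ s} = maximalIdeal A) (N : Ideal A) (μ : ℕ) :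
    ∃ (t : A) (P' : Polynomial R) (c' : Fin 3 → A), c' 1 = φ u₁ ∧ φ u₀ = φ u₁ * c' 0 ∧
      φ u₂ = φ u₁ * t ∧ P'.Monic ∧ c' 2 = P'.eval₂ φ t ∧ 2 ≤ (P'.map (residue R)).natDegree ∧
      Irreducible (P'.map (residue R)) ∧
      (∀ G : Polynomial R, G.eval₂ φ t ∈ maximalIdeal A ↔ P'.map (residue R) ∣ G.map (residue R)) ∧
      Ideal.span {c' 0, c' 1, c' 2} = maximalIdeal A ∧
      Submodule.colon N ({φ u₂ ^ μ} : Set A) = Submodule.colon N ({φ u₁ ^ μ} : Set A) := by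
  have hdP : (P.map (residue R)).natDegree = P.natDegree := hPm.natDegree_map _
  -- `s` is a unit: `P̄ ∤ T`
  have hs : IsUnit s := by
    by_contra hns
    have hsm : (Polynomial.X : Polynomial R).eval₂ φ s ∈ maximalIdeal A := by
      rw [Polynomial.eval₂_X]; exact (IsLocalRing.mem_maximalIdeal s).mpr (mem_nonunits_iff.mpr hns)
    have hdvd := (hcrit _).mp hsm
    rw [Polynomial.map_X] at hdvd
    have h := Polynomial.natDegree_le_of_dvd hdvd Polynomial.X_ne_zero
    rw [Polynomial.natDegree_X] at h; omega
  obtain ⟨sU, rfl⟩ := hs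
  -- `P(0)` is a unit: `T ∤ P̄`
  have hPb0 : (P.map (residue R)).coeff 0 ≠ 0 := by
    intro h0
    obtain ⟨H, hH⟩ := Polynomial.X_dvd_iff.mpr h0
    rcases hPi.isUnit_or_isUnit hH with hX | hH1
    · exact Polynomial.not_isUnit_X hX
    · have h2 := Polynomial.natDegree_mul_le (p := (Polynomial.X : Polynomial (ResidueField R))) (q := H)
      rw [← hH, Polynomial.natDegree_X, Polynomial.natDegree_eq_zero_of_isUnit hH1] at h2; omega
  have hp0 : IsUnit (P.coeff 0) := by
    refine (residue_ne_zero_iff_isUnit _).mp ?_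
    rw [← Polynomial.coeff_map]; exact hPb0
  obtain ⟨pU, hpU⟩ := hp0
  -- the reciprocal polynomial
  set d := P.natDegree with hd
  have hRle : (P.reflect d).natDegree ≤ d := Polynomial.natDegree_reflect_le.trans (le_of_eq (max_self _))
  have hRcoef : (P.reflect d).coeff d = P.coeff 0 := by
    rw [Polynomial.coeff_reflect, Polynomial.revAt_le le_rfl, Nat.sub_self]
  let P' : Polynomial R := Polynomial.C (↑pU⁻¹ : R) * P.reflect d
  have hP'le : P'.natDegree ≤ d :=
    (Polynomial.natDegree_C_mul_le _ _).trans hRle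
  have hP'coef : P'.coeff d = 1 := by
    rw [Polynomial.coeff_C_mul, hRcoef, ← hpU, Units.inv_mul]
  have hP'm : P'.Monic := Polynomial.monic_of_natDegree_le_of_coeff_eq_one d hP'le hP'coef
  have hP'd : P'.natDegree = d :=
    le_antisymm hP'le (Polynomial.le_natDegree_of_ne_zero (by rw [hP'coef]; exact one_ne_zero))
  have hP'map : P'.map (residue R) = Polynomial.C (residue R ↑pU⁻¹) * (P.map (residue R)).reflect d := by
    rw [Polynomial.map_mul, Polynomial.map_C, Polynomial.reflect_map]
  have hcU : IsUnit (Polynomial.C (residue R ↑pU⁻¹)) :=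
    Polynomial.isUnit_C.mpr ((Units.map (residue R : R →* ResidueField R) pU⁻¹).isUnit)
  -- inverses
  letI : Invertible (↑sU : A) := sU.invertible
  have hinv : ⅟(↑sU : A) = ↑sU⁻¹ := invOf_units sU
  letI iT : Invertible (↑sU⁻¹ : A) := (sU⁻¹).invertible
  have hinv' : ⅟(↑sU⁻¹ : A) = ↑sU := by rw [invOf_units, inv_inv]
  -- `P(s) = (φ P(0) · s^d) · P′(s⁻¹)`
  have hrefl : (P.reflect d).eval₂ φ ↑sU⁻¹ * ↑sU ^ d = P.eval₂ φ ↑sU := by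
    rw [← hinv]; exact Polynomial.eval₂_reflect_mul_pow φ _ d P le_rfl
  have hPP' : P.eval₂ φ ↑sU = (φ ↑pU * ↑sU ^ d) * P'.eval₂ φ ↑sU⁻¹ := by
    rw [← hrefl, Polynomial.eval₂_mul, Polynomial.eval₂_C]
    have : φ (↑pU : R) * φ ↑pU⁻¹ = 1 := by rw [← map_mul, Units.mul_inv, map_one]
    linear_combination (-(Polynomial.eval₂ φ (↑sU⁻¹) (P.reflect d) * ↑sU ^ d)) * this
  have hw : IsUnit (φ ↑pU * ↑sU ^ d : A) :=
    ((Units.map (φ : R →* A) pU).isUnit).mul (sU ^ d).isUnit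
  -- the new criterion
  have hcrit' : ∀ G : Polynomial R, G.eval₂ φ ↑sU⁻¹ ∈ maximalIdeal A ↔
      P'.map (residue R) ∣ G.map (residue R) := by
    intro G
    have hG : (G.reflect G.natDegree).eval₂ φ ↑sU * ↑sU⁻¹ ^ G.natDegree = G.eval₂ φ ↑sU⁻¹ := by
      rw [← hinv']; exact Polynomial.eval₂_reflect_mul_pow φ _ G.natDegree G le_rfl
    rw [← hG, Ideal.mul_unit_mem_iff_mem _ ((sU⁻¹).isUnit.pow G.natDegree), hcrit, ← Polynomial.reflect_map,
      Polynomial.dvd_reflect_iff_reflect_dvd (hPm.map _) hPb0 (Polynomial.natDegree_map_le), hdP, hP'map,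
      IsUnit.mul_left_dvd hcU]
  have hP'2 : 2 ≤ (P'.map (residue R)).natDegree := by rw [hP'm.natDegree_map, hP'd, ← hdP]; exact hP2
  refine ⟨↑sU⁻¹, P', ![↑sU⁻¹ * y₂, φ u₁, P'.eval₂ φ ↑sU⁻¹], rfl, ?_, ?_, hP'm, rfl, hP'2,
    irreducible_map_residue_of_criterion φ _ (by omega) hcrit', hcrit', ?_, ?_⟩
  · show φ u₀ = φ u₁ * (↑sU⁻¹ * y₂)
    rw [h0, h1, mul_assoc, Units.mul_inv_cancel_left]
  · rw [h1, mul_assoc, Units.mul_inv, mul_one]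
  · show Ideal.span {↑sU⁻¹ * y₂, φ u₁, P'.eval₂ φ ↑sU⁻¹} = maximalIdeal A
    obtain ⟨wU, hwU⟩ := hw
    have e2 : φ u₁ = ↑sU * φ u₂ := by rw [h1, mul_comm]
    have e3 : P'.eval₂ φ ↑sU⁻¹ = ↑wU⁻¹ * P.eval₂ φ ↑sU := by
      rw [hPP', ← hwU, Units.inv_mul_cancel_left]
    rw [e2, e3, Ideal.span_triple_eq_of_isUnit_mul (sU⁻¹).isUnit sU.isUnit (wU⁻¹).isUnit, hgen]
  · have e : φ u₁ ^ μ = ↑(sU ^ μ) * φ u₂ ^ μ := by rw [h1, mul_pow, mul_comm, Units.val_pow_eq_pow_val]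
    rw [e, Submodule.colon_singleton_eq_of_isUnit_mul N (sU ^ μ).isUnit]

end Literature.AlgebraicGeometry.Resolution

end
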